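import Summits.ResolutionOfSingularities.ResolutionOfSingularities.Theorems.HilbertSamuelEliminationCampaignW42TertiaryCompactness
import Mathlib.Topology.NoetherianSpace
import Mathlib.Topology.Separation.Basic
import HarnessLib

/-!
# [OURS · L1 W4.2] Compactness for ARBITRARY maximal strata: an infinite canonical sequence `S(X, ν)` carries an
# infinite chain of closed near points starting at SOME closed point of `X(ν)` — the isolation hypothesis
# `X(ν) = {x}` of the Compactness file removed (`--supports stmt-ResolutionOfSingularities-17846`)

OURS (slot W4.2 of cell res-hironaka, LADDER-RESOLUTION rung L, D-0089; prover seat res-L1-s42-pv-2, gen 2); NOT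
statements of H. Hironaka's manuscript [Hironaka2017]; nothing of the manuscript is used or asserted. AI review is
weaker than expert review. Pure PROOF file; no new definition (the «good marked stage» of the Compactness file,
`MarkedGood`, carries the scope of an ISOLATED origin; here its four clauses are spelled inline without the scope).

The Compactness file (p478155) proved, at an ISOLATED origin `X(ν) = {x}`, that an infinite `S(X, ν)` carries an
infinite chain of closed near points from `x` (König's lemma over the proper exceptional towers). CJS reduce to the
isolated case in dimension two («we may assume that `X(ν̃)` just consists of `x`», p. 98 Step 9); in higher dimension
no such reduction is available (Corridor3's open core `stub_confinedWildNu3` confines the stratum over finitely many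
closed points downstairs but not upstairs). This file removes the isolation:

* `exists_canonicalNearStep_of_persistent` — THE SUCCESSOR STEP for a marked stage with CLOSED PERSISTENT marked point
  in a good state from which `S` is infinite (verbatim the Compactness file's argument, scope-free).
* `exists_persistent_closedPt` — THE INITIAL POINT: if `S(X, ν)` is infinite from a good initial state, SOME CLOSED
  POINT `x₀ ∈ X(ν)` is persistent (every canonical run has a stratum point over it): the images `B_m ⊆ X` of the
  depth-`m` strata are closed (proper), non-empty, decreasing, hence stabilise (Noetherian `X`); a closed point of
  their intersection.
* `exists_nearChain_of_canonicalSequenceInfinite_general` — THE CHAIN: dependent choice.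
* `not_canonicalSequenceInfinite_of_forall_noNearChain` — hence: if NO closed point of `X(ν)` starts an infinite near
  chain (the pointwise O2-type statement at every closed point of the stratum), `S(X, ν)` is not infinite.

## References

* V. Cossart, U. Jannsen, S. Saito, LNM 2270 (2020), Rem. 6.29 (1), p. 98 Step 9, p. 105, p. 107. [CossartJannsenSaito2020]
-/

noncomputable section

set_option linter.dupNamespace false -- mandated namespace of this single-conjunct summit

open CategoryTheory AlgebraicGeometry TopologicalSpace Topology

namespace Summit.ResolutionOfSingularities.ResolutionOfSingularities.Theorems

namespace CampaignW42

open Literature.AlgebraicGeometry.Resolution Literature.RingTheory.HilbertSamuel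

universe u

variable {R : ∀ S : Scheme.{u}, CentreSeq S → Prop} {N : ℕ} {ν : ℕ → ℕ}
variable {k : Type u} [Field k]

/-! ## The successor step, scope-free -/

/-- **THE SUCCESSOR STEP, scope-free.** From a marked stage whose marked point is CLOSED and PERSISTENT (every canonical
run from the state has a stratum point over it), in a good state from which `S` has runs of every length, there is a
canonical near step to a marked stage of the same kind (functional oracle). The sets `A_m` of points of the blow-up
over the marked point carrying a stratum point at depth `m` are closed, non-empty, decreasing; they stabilise
(Noetherian induction) and a closed point of their intersection is the next marked point.
[cite: CossartJannsenSaito2020, p. 105] -/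
theorem exists_canonicalNearStep_of_persistent (hRf : OracleFunctional R) {s : MarkedStage.{u}}
    (hcl : IsClosed ({s.pt} : Set s.W)) (hgood : StateGood k R N ν s.W s.L s.P)
    (hinf : ∀ m, ∃ t : CentreSeq s.W, IsCanonicalRunFrom R N ν s.L s.P t ∧ t.length = m)
    (hpers : ∀ t : CentreSeq s.W, IsCanonicalRunFrom R N ν s.L s.P t →
      ∃ z : t.top, z ∈ Scheme.hsStratum t.top N ν ∧ t.comp.base z = s.pt) :
    ∃ s', CanonicalNearStep R N ν s s' ∧ IsClosed ({s'.pt} : Set s'.W) ∧ StateGood k R N ν s'.W s'.L s'.P ∧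
      (∀ m, ∃ t : CentreSeq s'.W, IsCanonicalRunFrom R N ν s'.L s'.P t ∧ t.length = m) ∧
      ∀ t : CentreSeq s'.W, IsCanonicalRunFrom R N ν s'.L s'.P t →
        ∃ z : t.top, z ∈ Scheme.hsStratum t.top N ν ∧ t.comp.base z = s'.pt := by
  haveI : IsLocallyNoetherian s.W := s.ln
  -- the canonical step from `s`
  obtain ⟨t₁, ht₁, hlen₁⟩ := hinf 1
  obtain ⟨C, rest₁, rfl⟩ : ∃ (C : s.W.IdealSheafData) (rest : CentreSeq (blowup C)),
      t₁ = CentreSeq.cons C rest := by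
    cases t₁ with
    | nil _ => simp at hlen₁
    | cons C rest => exact ⟨C, rest, rfl⟩
  obtain ⟨P', hst, -⟩ := ht₁
  have hgood' : StateGood k R N ν (blowup C) (s.L.next (Scheme.hsStratum s.W N ν) C) P' := hgood.next hst
  haveI : IsLocallyNoetherian (blowup C) := hgood'.isLocallyNoetherian
  haveI : IsNoetherian (blowup C) := hgood'.isNoetherian
  -- runs from the next state
  have hinf' : ∀ m, ∃ r : CentreSeq (blowup C),
      IsCanonicalRunFrom R N ν (s.L.next (Scheme.hsStratum s.W N ν) C) P' r ∧ r.length = m := by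
    intro m
    obtain ⟨t, ht, hlen⟩ := hinf (m + 1)
    obtain ⟨rest, rfl, hrest, hrlen⟩ := exists_eq_cons_of_run hRf hst ht hlen
    exact ⟨rest, hrest, hrlen⟩
  choose r hr hrlen using hinf'
  -- the sets `A m`
  let A : ℕ → Set ↥(blowup C) := fun m =>
    {y' | (blowup.π C).base y' = s.pt ∧
      ∃ z : (r m).top, z ∈ Scheme.hsStratum (r m).top N ν ∧ (r m).comp.base z = y'}
  have hruniq : ∀ {m} (t : CentreSeq (blowup C)),
      IsCanonicalRunFrom R N ν (s.L.next (Scheme.hsStratum s.W N ν) C) P' t → t.length = m → t = r m :=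
    fun t ht hlen => IsCanonicalRunFrom.eq_of_length_eq hRf ht (hr _) (hlen.trans (hrlen _).symm)
  have hAclosed : ∀ m, IsClosed (A m) := by
    intro m
    obtain ⟨L'', P''', hgtop⟩ := exists_stateGood_top_of_run m hgood' (r m) (hr m) (hrlen m)
    have h1 : IsClosed ((fun y' : ↥(blowup C) => (blowup.π C).base y') ⁻¹' {s.pt}) :=
      hcl.preimage (blowup.π C).continuous
    haveI : IsProper (r m).comp := CentreSeq.isProper_comp (r m)
    have h2 : IsClosed ((fun z : ↥((r m).top) => (r m).comp.base z) '' Scheme.hsStratum (r m).top N ν) :=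
      (r m).comp.isClosedMap _ hgtop.isClosed_hsStratum
    have hA : A m = ((fun y' : ↥(blowup C) => (blowup.π C).base y') ⁻¹' {s.pt}) ∩
        ((fun z : ↥((r m).top) => (r m).comp.base z) '' Scheme.hsStratum (r m).top N ν) := by
      ext y'
      simp only [A, Set.mem_setOf_eq, Set.mem_inter_iff, Set.mem_preimage, Set.mem_singleton_iff, Set.mem_image]
    rw [hA]
    exact h1.inter h2
  have hAne : ∀ m, (A m).Nonempty := by
    intro m
    obtain ⟨z, hz, hzeq⟩ := hpers (CentreSeq.cons C (r m)) ⟨P', hst, hr m⟩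
    exact ⟨(r m).comp.base z, hzeq, z, hz, rfl⟩
  have hAanti : ∀ m, A (m + 1) ⊆ A m := by
    intro m y' hy'
    obtain ⟨hπ, z', hz', hzeq'⟩ := hy'
    obtain ⟨t, ht, htlen, z, hz, hzeq⟩ :=
      exists_run_pred_of_run_succ m hgood' (r (m + 1)) (hr _) (hrlen _) z' hz'
    obtain rfl : t = r m := hruniq t ht htlen
    exact ⟨hπ, z, hz, hzeq.trans hzeq'⟩
  have hAanti' : Antitone A := antitone_nat_of_succ_le hAanti
  obtain ⟨M, hM⟩ : ∃ M, ∀ m, M ≤ m → A m = A M := by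
    let F : ℕ → Closeds ↥(blowup C) := fun m => ⟨A m, hAclosed m⟩
    obtain ⟨B, ⟨M, rfl⟩, hmin⟩ :=
      (wellFounded_lt (α := Closeds ↥(blowup C))).has_min (Set.range F) ⟨F 0, 0, rfl⟩
    refine ⟨M, fun m hm => ?_⟩
    have hle : F m ≤ F M := hAanti' hm
    have hnlt : ¬ F m < F M := hmin (F m) ⟨m, rfl⟩
    have heq : F m = F M := hle.eq_or_lt.resolve_right hnlt
    exact congrArg (fun B : Closeds ↥(blowup C) => (B : Set ↥(blowup C))) heq
  haveI : CompactSpace ↥(blowup C) := inferInstance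
  obtain ⟨y', hy'M, hy'cl⟩ := (hAclosed M).exists_closed_singleton (hAne M)
  have hy' : ∀ m, y' ∈ A m := by
    intro m
    rcases le_total M m with hm | hm
    · rw [hM m hm]; exact hy'M
    · exact hAanti' hm hy'M
  obtain ⟨hπy', z₀, hz₀, hz₀eq⟩ := hy' 0
  have hr0 : r 0 = CentreSeq.nil _ := by
    have := hrlen 0
    cases h : r 0 with
    | nil _ => rfl
    | cons _ _ => rw [h] at this; simp at this
  have hy'str : y' ∈ Scheme.hsStratum (blowup C) N ν := by
    have key : ∀ (t : CentreSeq (blowup C)) (ht : t = CentreSeq.nil _) (z : t.top),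
        z ∈ Scheme.hsStratum t.top N ν → t.comp.base z = y' → y' ∈ Scheme.hsStratum (blowup C) N ν := by
      intro t ht z hz hzeq
      subst ht
      simpa using (show (CentreSeq.nil (blowup C)).comp.base z = y' from hzeq) ▸ hz
    exact key (r 0) hr0 z₀ hz₀ hz₀eq
  refine ⟨⟨blowup C, inferInstance, s.L.next (Scheme.hsStratum s.W N ν) C, P', y'⟩,
    ⟨C, P', inferInstance, y', hst, hπy', hy'cl, hy'str, rfl⟩, hy'cl, hgood', fun m => ⟨r m, hr m, hrlen m⟩,
    fun t ht => ?_⟩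
  have ht' : t = r t.length := hruniq t ht rfl
  obtain ⟨-, z, hz, hzeq⟩ := hy' t.length
  rw [ht']
  exact ⟨z, hz, hzeq⟩

/-! ## The initial point -/

/-- **THE INITIAL POINT.** If `S(X, ν)` is infinite from a good initial state (functional oracle), some CLOSED point
`x₀ ∈ X(ν)` is PERSISTENT: every canonical run has a stratum point over `x₀`. The images `B_m ⊆ X` of the depth-`m`
strata are closed (proper images of closed strata), non-empty and decreasing; they stabilise (`X` Noetherian) and a
closed point of their intersection will do (`B_0 = X(ν)`). [cite: CossartJannsenSaito2020, p. 105, p. 107] -/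
theorem exists_persistent_closedPt (hRf : OracleFunctional R) {X : Scheme.{u}}
    (hgood : StateGood k R N ν X (Labelling.init X) none) (hinf : CanonicalSequenceInfinite R N ν X) :
    ∃ x : X, x ∈ Scheme.hsStratum X N ν ∧ IsClosed ({x} : Set X) ∧
      ∀ t : CentreSeq X, t.IsCanonicalRun R N ν →
        ∃ z : t.top, z ∈ Scheme.hsStratum t.top N ν ∧ t.comp.base z = x := by
  haveI : IsLocallyNoetherian X := hgood.isLocallyNoetherian
  haveI : IsNoetherian X := hgood.isNoetherian
  choose r hr hrlen using hinf
  have hruniq : ∀ {m} (t : CentreSeq X), t.IsCanonicalRun R N ν → t.length = m → t = r m :=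
    fun t ht hlen => CentreSeq.IsCanonicalRun.eq_of_length_eq hRf ht (hr _) (hlen.trans (hrlen _).symm)
  let B : ℕ → Set X := fun m =>
    {y | ∃ z : (r m).top, z ∈ Scheme.hsStratum (r m).top N ν ∧ (r m).comp.base z = y}
  have hBclosed : ∀ m, IsClosed (B m) := by
    intro m
    obtain ⟨L'', P''', hgtop⟩ := exists_stateGood_top_of_run m hgood (r m) (hr m) (hrlen m)
    haveI : IsProper (r m).comp := CentreSeq.isProper_comp (r m)
    have h2 : IsClosed ((fun z : ↥((r m).top) => (r m).comp.base z) '' Scheme.hsStratum (r m).top N ν) :=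
      (r m).comp.isClosedMap _ hgtop.isClosed_hsStratum
    have hB : B m = (fun z : ↥((r m).top) => (r m).comp.base z) '' Scheme.hsStratum (r m).top N ν := by
      ext y
      simp only [B, Set.mem_setOf_eq, Set.mem_image]
    rw [hB]
    exact h2
  have hBne : ∀ m, (B m).Nonempty := by
    intro m
    obtain ⟨z, hz⟩ := hsStratum_top_nonempty_of_runs hRf m (r m) (hr m) (hrlen m) ⟨r (m + 1), hr _, hrlen _⟩
    exact ⟨(r m).comp.base z, z, hz, rfl⟩
  have hBanti : ∀ m, B (m + 1) ⊆ B m := by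
    intro m y hy
    obtain ⟨z', hz', hzeq'⟩ := hy
    obtain ⟨t, ht, htlen, z, hz, hzeq⟩ := exists_run_pred_of_run_succ m hgood (r (m + 1)) (hr _) (hrlen _) z' hz'
    obtain rfl : t = r m := hruniq t ht htlen
    exact ⟨z, hz, hzeq.trans hzeq'⟩
  have hBanti' : Antitone B := antitone_nat_of_succ_le hBanti
  obtain ⟨M, hM⟩ : ∃ M, ∀ m, M ≤ m → B m = B M := by
    let F : ℕ → Closeds X := fun m => ⟨B m, hBclosed m⟩
    obtain ⟨B', ⟨M, rfl⟩, hmin⟩ := (wellFounded_lt (α := Closeds X)).has_min (Set.range F) ⟨F 0, 0, rfl⟩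
    refine ⟨M, fun m hm => ?_⟩
    have hle : F m ≤ F M := hBanti' hm
    have hnlt : ¬ F m < F M := hmin (F m) ⟨m, rfl⟩
    have heq : F m = F M := hle.eq_or_lt.resolve_right hnlt
    exact congrArg (fun B : Closeds X => (B : Set X)) heq
  haveI : CompactSpace X := inferInstance
  obtain ⟨x, hxM, hxcl⟩ := (hBclosed M).exists_closed_singleton (hBne M)
  have hx : ∀ m, x ∈ B m := by
    intro m
    rcases le_total M m with hm | hm
    · rw [hM m hm]; exact hxM
    · exact hBanti' hm hxM
  have hr0 : r 0 = CentreSeq.nil _ := by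
    have := hrlen 0
    cases h : r 0 with
    | nil _ => rfl
    | cons _ _ => rw [h] at this; simp at this
  have hxstr : x ∈ Scheme.hsStratum X N ν := by
    obtain ⟨z₀, hz₀, hz₀eq⟩ := hx 0
    have key : ∀ (t : CentreSeq X) (ht : t = CentreSeq.nil _) (z : t.top),
        z ∈ Scheme.hsStratum t.top N ν → t.comp.base z = x → x ∈ Scheme.hsStratum X N ν := by
      intro t ht z hz hzeq
      subst ht
      simpa using (show (CentreSeq.nil X).comp.base z = x from hzeq) ▸ hz
    exact key (r 0) hr0 z₀ hz₀ hz₀eq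
  refine ⟨x, hxstr, hxcl, fun t ht => ?_⟩
  have ht' : t = r t.length := hruniq t ht rfl
  obtain ⟨z, hz, hzeq⟩ := hx t.length
  rw [ht']
  exact ⟨z, hz, hzeq⟩

/-! ## The chain -/

/-- **AN INFINITE `S(X, ν)` CARRIES AN INFINITE CHAIN OF CLOSED NEAR POINTS FROM SOME CLOSED POINT OF `X(ν)`**
(good initial state, functional oracle) — the isolation-free converse of `canonicalSequenceInfinite_of_chain`.
[cite: CossartJannsenSaito2020, p. 105, p. 107] -/
theorem exists_nearChain_of_canonicalSequenceInfinite_general (hRf : OracleFunctional R) {X : Scheme.{u}}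
    [IsLocallyNoetherian X] (hgood : StateGood k R N ν X (Labelling.init X) none)
    (hinf : CanonicalSequenceInfinite R N ν X) :
    ∃ (x : X) (c : ℕ → MarkedStage.{u}), x ∈ Scheme.hsStratum X N ν ∧ IsClosed ({x} : Set X) ∧
      c 0 = MarkedStage.init X x ∧ ∀ n, CanonicalNearStep R N ν (c n) (c (n + 1)) := by
  obtain ⟨x, hxstr, hxcl, hpers⟩ := exists_persistent_closedPt hRf hgood hinf
  let G : MarkedStage.{u} → Prop := fun s =>
    IsClosed ({s.pt} : Set s.W) ∧ StateGood k R N ν s.W s.L s.P ∧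
      (∀ m, ∃ t : CentreSeq s.W, IsCanonicalRunFrom R N ν s.L s.P t ∧ t.length = m) ∧
      ∀ t : CentreSeq s.W, IsCanonicalRunFrom R N ν s.L s.P t →
        ∃ z : t.top, z ∈ Scheme.hsStratum t.top N ν ∧ t.comp.base z = s.pt
  have h0 : G (MarkedStage.init X x) := ⟨hxcl, hgood, hinf, hpers⟩
  have hsucc : ∀ s : {s : MarkedStage.{u} // G s}, ∃ s' : {s : MarkedStage.{u} // G s},
      CanonicalNearStep R N ν s.1 s'.1 := by
    rintro ⟨s, hcl, hg, hi, hp⟩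
    obtain ⟨s', hss', hcl', hg', hi', hp'⟩ := exists_canonicalNearStep_of_persistent hRf hcl hg hi hp
    exact ⟨⟨s', hcl', hg', hi', hp'⟩, hss'⟩
  choose g hg using hsucc
  let c : ℕ → {s : MarkedStage.{u} // G s} := fun n => Nat.rec ⟨MarkedStage.init X x, h0⟩ (fun _ s => g s) n
  exact ⟨x, fun n => (c n).1, hxstr, hxcl, rfl, fun n => hg (c n)⟩

/-- **NO CLOSED POINT OF `X(ν)` STARTS AN INFINITE NEAR CHAIN ⇒ `S(X, ν)` IS NOT INFINITE** (good initial state,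
functional oracle): the pointwise O2-type statement at the closed points of an ARBITRARY maximal stratum excludes an
infinite canonical sequence. [cite: CossartJannsenSaito2020, Rem. 6.29 (1), p. 107] -/
theorem not_canonicalSequenceInfinite_of_forall_noNearChain (hRf : OracleFunctional R) {X : Scheme.{u}}
    [IsLocallyNoetherian X] (hgood : StateGood k R N ν X (Labelling.init X) none)
    (h : ∀ x ∈ Scheme.hsStratum X N ν, IsClosed ({x} : Set X) →
      NoNearChainFrom R N ν (MarkedStage.init X x) fun _ => True) :
    ¬ CanonicalSequenceInfinite R N ν X := by
  intro hinf
  obtain ⟨x, c, hxstr, hxcl, hc0, hstep⟩ := exists_nearChain_of_canonicalSequenceInfinite_general hRf hgood hinf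
  exact h x hxstr hxcl ⟨c, hc0 ▸ Relation.ReflTransGen.refl, hstep, fun _ => trivial⟩

end CampaignW42

end Summit.ResolutionOfSingularities.ResolutionOfSingularities.Theorems

end
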